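import Summits.QuantumFields.YangMills.Theorems.UnitScaleTiltProp7CovPuncturedCaccioppoli
import Summits.QuantumFields.YangMills.Theorems.UnitScaleTiltProp7TorusRadialSums
import Literature.MathematicalPhysics.QuantumFieldTheory.Balaban1983to89.B3Taylor310LocalRemainder
import Literature.MathematicalPhysics.QuantumFieldTheory.Balaban1983to89.MatrixNorms
import HarnessLib

/-!
# Route `UnitScaleTilt`, crux K1 «MinimiserStabilityRegPr» (stmt-QuantumFields-19200), route-R E′ path (α′), (E1-b) covariant, row (hK₂-cov) — FILE F3d-cov «COV-PIN-JUNK-SUMS»: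
# THE `s²`-WEIGHTED GRADIENT ENERGY AND THE `L¹` GRADIENT MASS OF A COVARIANTLY HARMONIC MATRIX FIELD ON A PUNCTURED PIN BALL —
# `Σ_{1≤s≤R+1} s²·Σ_μ hs(D_UV) ≤ 27·Σ_{s≤2R+3} hs V` and `Σ_{1≤s≤R+1} Σ_μ ‖D_UV‖ ≤ √(576(R+1))·√(27·Σ_{s≤2R+3} hs V)` (`s = tdist(·,y)`, d = 3), by the tent cutoff in (C1)

Cell `ym3-torus`, width seat `ym3-torus-px11` (gen 3), LEAD of the (hK₂-cov) chain (routeR-w3 g6 WORDS (8)–(10)); LOCATE 19200 evidence #57 `LOCATE-HK2COV-px11g3.md` §1 rows (Q)(PIN)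
(«junk in L¹, not Cauchy–Schwarz in one go»).  `--kind proof --supports stmt-QuantumFields-19200 --as helper`, count-neutral.  THEOREMS ONLY (0 `def`, 0 `sorry`).
YM₃ on T³ is a ladder rung (R3) — not d = 4, not infinite volume, not a mass gap, not the Clay problem; nothing here claims the stub, the crux or the gap.

THE POINT.  The frame junk `f = Δ_h v − Δ₁v` of the (Q)∕(PIN) transplant is bounded pointwise by `Φ = Σ_μ[2τ₁(‖D_UV(z,μ)‖ + ‖D_UV(z−e_μ,μ)‖ + …) + (2τ₂+4τ₁²)‖V(z−e_μ)‖]`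
(✓ `Prop7CovPinCharge.norm_laplace_one_framed_le`).  Its `L¹` mass and its `s²`-weighted `L²` mass near the pin must be `O(e)` AT THE RIGHT POWER OF `ℓ`; the first-difference
terms are paid by the `s²`-weighted gradient energy of `V` on the PUNCTURED ball, which (C1) ✓ `Prop7CovPuncturedCaccioppoli.sum_sq_mul_hs_covD_le_of_support` controls with the
TENT cutoff `ψ = max(0, min(s, 2(R+1) − s))` (`ψ(y) = 0` kills the pin, `ψ = s` on `s ≤ R+1`, `|ψ(z+e_μ) − ψ(z)| ≤ 1` by the one-step bound on `tdist`), and then Cauchy–Schwarz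
against `Σ_{1≤s≤R+1} s⁻² ≤ 192(R+1)` (routeR-w3 g6 ✓ `Prop7TorusRadialSums.sum_inv_tdist_sq_le`).

WHAT IS PROVED (ns `…Theorems.Prop7CovPinJunkSums`; torus `Site P 0`… any level `i`, `P.d = 3` where radial sums enter; unitary `U`; `hs`; `s z := tdist z y`).
* §1 tent letters: `tent_abs_sub_le` (1-Lipschitz in `s`), `tent_shift_sub_le_one`, `tent_eq_of_le` (`s ≤ R+1 ⇒ ψ = s`), `tent_ne_zero` (`ψ ≠ 0 ⇒ 0 < s < 2(R+1)`),
  `tdist_shift_le_succ`∕`tdist_le_tdist_shift_succ` (one step changes `s` by at most one).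
* §2 ★★ `sum_tent_sq_hs_covD_le` — (C1) with the tent: `Σ_z ψ(z)²Σ_μ hs(D_μV z) ≤ 9d·Σ_{s ≤ 2R+3} hs V` for `V` covariantly harmonic on `{0 < s ≤ 2R+2}`;
  ★★ `sum_punctured_sq_hs_covD_le` — `Σ_{1≤s≤R+1} s²·Σ_μ hs(D_μV z) ≤ 9d·Σ_{s≤2R+3} hs V`.
* §3 ★★★ `sum_punctured_norm_covD_le` — `d = 3`: `Σ_{1≤s≤R+1} Σ_μ ‖D_μV z‖ ≤ √(576(R+1))·√(27·Σ_{s≤2R+3} hs V)` (op norm ≤ HS norm, Cauchy–Schwarz, radial sum).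
HONEST SCOPE.  Bookkeeping over (C1) and the radial sums; the `Φ`-sums proper ((J1) `L¹`, (J2) weighted `L²`) are assembled from §2–§3 in F3c∕F4-cov.  Nothing of Bałaban's is asserted.

References: M. Giaquinta, Princeton UP 1983 [Giaquinta1984] (Ch. III §1); T. Bałaban, CMP 99 (1985) 389–434 [Balaban1985BackgroundPropagators] ((3.3), (3.8) pp.390–392).
-/

set_option autoImplicit false

noncomputable section

open scoped BigOperators Matrix.Norms.L2Operator Matrix

namespace Summit.QuantumFields.YangMills.Theorems.Prop7CovPinJunkSums

open Literature.MathematicalPhysics.QuantumFieldTheory.Balaban1983to89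
open Finset
open B9Eq39Adjoint (R covD divB)
open B9TorusCalculus (torusT torusT_apply)
open B3Taylor310LocalRemainder (tdist_comm tdist_self tdist_triangle tdist_unshift_le_one)
open Summit.QuantumFields.YangMills.Theorems.Prop7CovPuncturedCaccioppoli (sum_sq_mul_hs_covD_le_of_support)
open Summit.QuantumFields.YangMills.Theorems.Prop7TorusRadialSums (card_ball_le_real sum_inv_tdist_sq_le)

variable {P : Params} {i : ℕ} {N : ℕ}

/-! ## §1 The tent cutoff around a pin -/

section Tent

/-- One lattice step changes the distance to `y` by at most one: `tdist(z+e_μ, y) ≤ tdist(z, y) + 1`. [folklore] -/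
theorem tdist_shift_le_succ (z y : Site P i) (μ : Fin P.d) : Site.tdist (z.shift μ) y ≤ Site.tdist z y + 1 := by
  have h1 : Site.tdist (z.shift μ) z ≤ 1 := by
    have h := tdist_unshift_le_one (z.shift μ) μ
    rwa [Site.unshift_shift, tdist_comm] at h
  have h2 := tdist_triangle (z.shift μ) z y
  omega

/-- … and `tdist(z, y) ≤ tdist(z+e_μ, y) + 1`. [folklore] -/
theorem tdist_le_tdist_shift_succ (z y : Site P i) (μ : Fin P.d) : Site.tdist z y ≤ Site.tdist (z.shift μ) y + 1 := by
  have h1 : Site.tdist z (z.shift μ) ≤ 1 := by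
    have h := tdist_unshift_le_one (z.shift μ) μ
    rwa [Site.unshift_shift] at h
  have h2 := tdist_triangle z (z.shift μ) y
  omega

/-- The tent profile `t ↦ max 0 (min t (c − t))` is 1-Lipschitz. [folklore] -/
theorem tent_abs_sub_le (c a b : ℝ) : |max 0 (min a (c - a)) - max 0 (min b (c - b))| ≤ |a - b| := by
  have h1 : |max 0 (min a (c - a)) - max 0 (min b (c - b))| ≤ |min a (c - a) - min b (c - b)| := by
    have h := abs_max_sub_max_le_abs (min a (c - a)) (min b (c - b)) 0
    rwa [max_comm (min a (c - a)), max_comm (min b (c - b))] at h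
  have h2 : |min a (c - a) - min b (c - b)| ≤ max |a - b| |(c - a) - (c - b)| := abs_min_sub_min_le_max _ _ _ _
  have h3 : |(c - a) - (c - b)| = |a - b| := by rw [show (c - a) - (c - b) = -(a - b) by ring, abs_neg]
  rw [h3, max_self] at h2
  exact h1.trans h2

/-- The tent `ψ z := max 0 (min s (2(R+1) − s))`, `s = tdist(z,y)`, changes by at most one along a bond. [folklore] -/
theorem tent_shift_sub_le_one (y : Site P i) (R : ℕ) (z : Site P i) (μ : Fin P.d) :
    |max 0 (min ((Site.tdist (z.shift μ) y : ℕ) : ℝ) (2 * ((R : ℝ) + 1) - ((Site.tdist (z.shift μ) y : ℕ) : ℝ)))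
        - max 0 (min ((Site.tdist z y : ℕ) : ℝ) (2 * ((R : ℝ) + 1) - ((Site.tdist z y : ℕ) : ℝ)))| ≤ 1 := by
  refine (tent_abs_sub_le _ _ _).trans ?_
  have h1 := tdist_shift_le_succ z y μ
  have h2 := tdist_le_tdist_shift_succ z y μ
  rw [abs_le]
  constructor
  · have : ((Site.tdist z y : ℕ) : ℝ) ≤ ((Site.tdist (z.shift μ) y : ℕ) : ℝ) + 1 := by exact_mod_cast h2
    linarith
  · have : ((Site.tdist (z.shift μ) y : ℕ) : ℝ) ≤ ((Site.tdist z y : ℕ) : ℝ) + 1 := by exact_mod_cast h1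
    linarith

/-- On the inner ball the tent IS the distance: `s ≤ R + 1 ⇒ max 0 (min s (2(R+1) − s)) = s`. [folklore] -/
theorem tent_eq_of_le {s : ℕ} {R : ℕ} (hs : s ≤ R + 1) :
    max 0 (min ((s : ℕ) : ℝ) (2 * ((R : ℝ) + 1) - ((s : ℕ) : ℝ))) = (s : ℝ) := by
  have hs' : (s : ℝ) ≤ (R : ℝ) + 1 := by exact_mod_cast hs
  have h0 : (0 : ℝ) ≤ s := Nat.cast_nonneg _
  rw [min_eq_left (by linarith), max_eq_right h0]

/-- Where the tent is non-zero, `0 < s < 2(R+1)`. [folklore] -/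
theorem tent_ne_zero {s : ℕ} {R : ℕ} (h : max 0 (min ((s : ℕ) : ℝ) (2 * ((R : ℝ) + 1) - ((s : ℕ) : ℝ))) ≠ 0) :
    0 < s ∧ s < 2 * (R + 1) := by
  by_contra hc
  rw [not_and_or, not_lt, not_lt] at hc
  apply h
  rcases hc with hs | hs
  · have : s = 0 := Nat.le_zero.1 hs
    subst this
    simp
  · have hs' : 2 * ((R : ℝ) + 1) ≤ (s : ℝ) := by exact_mod_cast hs
    rw [min_eq_right (by linarith), max_eq_left (by linarith)]

end Tent

/-! ## §2 (C1) with the tent: the `s²`-weighted gradient energy on the punctured pin ball -/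

section Energy

variable {U : Fin P.d → Site P i → (Matrix (Fin N) (Fin N) ℂ)ˣ}

/-- ★★ **THE TENT ENERGY**: `V` covariantly harmonic on `{z : 0 < tdist(z,y) ≤ 2R+2}` (unitary `U`) ⇒
`Σ_z ψ(z)²·Σ_μ hs(D_μV z) ≤ 9d·Σ_{tdist(z,y) ≤ 2R+3} hs V(z)` for the tent `ψ = max 0 (min s (2(R+1) − s))` ((C1) ✓ `sum_sq_mul_hs_covD_le_of_support` with
`S = {s ≤ 2R+2}`, `S′ = {s ≤ 2R+3}`). [folklore] [cite: Giaquinta1984, Ch. III §1 Thm 1.2 p.70] -/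
theorem sum_tent_sq_hs_covD_le (hU : ∀ ν x, (U ν x : Matrix (Fin N) (Fin N) ℂ) ∈ unitary (Matrix (Fin N) (Fin N) ℂ))
    (V : Site P i → Matrix (Fin N) (Fin N) ℂ) (y : Site P i) (R : ℕ)
    (hV : ∀ z, 0 < Site.tdist z y → Site.tdist z y ≤ 2 * R + 2 → divB (torusT P i) U (fun μ => covD (torusT P i) U μ V) z = 0) :
    ∑ z : Site P i, ∑ μ : Fin P.d,
        (max 0 (min ((Site.tdist z y : ℕ) : ℝ) (2 * ((R : ℝ) + 1) - ((Site.tdist z y : ℕ) : ℝ)))) ^ 2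
          * ∑ j : Fin N, ∑ k : Fin N, ‖(covD (torusT P i) U μ V z) j k‖ ^ 2
      ≤ 9 * P.d * ∑ z ∈ Finset.univ.filter (fun z : Site P i => Site.tdist z y ≤ 2 * R + 3), ∑ j : Fin N, ∑ k : Fin N, ‖(V z) j k‖ ^ 2 := by
  classical
  set ψ : Site P i → ℝ := fun z => max 0 (min ((Site.tdist z y : ℕ) : ℝ) (2 * ((R : ℝ) + 1) - ((Site.tdist z y : ℕ) : ℝ))) with hψ
  have hVψ : ∀ x, ψ x ≠ 0 → divB (torusT P i) U (fun μ => covD (torusT P i) U μ V) x = 0 := by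
    intro x hx
    obtain ⟨h0, h2⟩ := tent_ne_zero (R := R) hx
    exact hV x h0 (by omega)
  have hlip : ∀ x μ, |ψ (x.shift μ) - ψ x| ≤ 1 := fun x μ => tent_shift_sub_le_one y R x μ
  set S : Finset (Site P i) := Finset.univ.filter (fun z : Site P i => Site.tdist z y ≤ 2 * R + 2) with hSdef
  set S' : Finset (Site P i) := Finset.univ.filter (fun z : Site P i => Site.tdist z y ≤ 2 * R + 3) with hS'def
  have hS : ∀ x μ, ψ (x.shift μ) - ψ x ≠ 0 → x ∈ S := by
    intro x μ h
    rw [hSdef, Finset.mem_filter]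
    refine ⟨Finset.mem_univ _, ?_⟩
    by_contra hx
    have hx' : 2 * R + 2 < Site.tdist x y := not_le.1 hx
    -- both tents vanish
    have h1 : ψ x = 0 := by
      by_contra h1; exact absurd (tent_ne_zero (R := R) h1).2 (by omega)
    have h2 : ψ (x.shift μ) = 0 := by
      by_contra h2
      have := (tent_ne_zero (R := R) h2).2
      have := tdist_le_tdist_shift_succ x y μ
      omega
    exact h (by rw [h1, h2, sub_zero])
  have hSS' : S ⊆ S' := by
    intro x hx
    rw [hSdef, Finset.mem_filter] at hx
    rw [hS'def, Finset.mem_filter]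
    exact ⟨hx.1, by omega⟩
  have hstep : ∀ x ∈ S, ∀ μ, x.shift μ ∈ S' := by
    intro x hx μ
    rw [hSdef, Finset.mem_filter] at hx
    rw [hS'def, Finset.mem_filter]
    exact ⟨Finset.mem_univ _, by have := tdist_shift_le_succ x y μ; omega⟩
  have h := sum_sq_mul_hs_covD_le_of_support hU ψ V hVψ hlip S S' hS hSS' hstep
  simpa only [hψ, Finset.mul_sum] using h

/-- ★★ **THE `s²`-WEIGHTED GRADIENT ENERGY ON THE PUNCTURED INNER BALL**: under the same hypotheses,
`Σ_{1 ≤ tdist(z,y) ≤ R+1} tdist(z,y)²·Σ_μ hs(D_μV z) ≤ 9d·Σ_{tdist(z,y) ≤ 2R+3} hs V(z)` (on the inner ball the tent equals the distance; the other terms are dropped).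
[folklore] [cite: Giaquinta1984, Ch. III §1 Thm 1.2 p.70] -/
theorem sum_punctured_sq_hs_covD_le (hU : ∀ ν x, (U ν x : Matrix (Fin N) (Fin N) ℂ) ∈ unitary (Matrix (Fin N) (Fin N) ℂ))
    (V : Site P i → Matrix (Fin N) (Fin N) ℂ) (y : Site P i) (R : ℕ)
    (hV : ∀ z, 0 < Site.tdist z y → Site.tdist z y ≤ 2 * R + 2 → divB (torusT P i) U (fun μ => covD (torusT P i) U μ V) z = 0) :
    ∑ z ∈ Finset.univ.filter (fun z : Site P i => 1 ≤ Site.tdist z y ∧ Site.tdist z y ≤ R + 1), ∑ μ : Fin P.d,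
        ((Site.tdist z y : ℕ) : ℝ) ^ 2 * ∑ j : Fin N, ∑ k : Fin N, ‖(covD (torusT P i) U μ V z) j k‖ ^ 2
      ≤ 9 * P.d * ∑ z ∈ Finset.univ.filter (fun z : Site P i => Site.tdist z y ≤ 2 * R + 3), ∑ j : Fin N, ∑ k : Fin N, ‖(V z) j k‖ ^ 2 := by
  classical
  refine le_trans ?_ (sum_tent_sq_hs_covD_le hU V y R hV)
  have hnn : ∀ z ∈ (Finset.univ : Finset (Site P i)), z ∉ Finset.univ.filter (fun z : Site P i => 1 ≤ Site.tdist z y ∧ Site.tdist z y ≤ R + 1) →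
      0 ≤ ∑ μ : Fin P.d, (max 0 (min ((Site.tdist z y : ℕ) : ℝ) (2 * ((R : ℝ) + 1) - ((Site.tdist z y : ℕ) : ℝ)))) ^ 2
          * ∑ j : Fin N, ∑ k : Fin N, ‖(covD (torusT P i) U μ V z) j k‖ ^ 2 :=
    fun z _ _ => Finset.sum_nonneg fun μ _ => mul_nonneg (sq_nonneg _) (Finset.sum_nonneg fun _ _ => Finset.sum_nonneg fun _ _ => sq_nonneg _)
  refine le_trans (le_of_eq ?_) (Finset.sum_le_sum_of_subset_of_nonneg (Finset.subset_univ _) hnn)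
  refine Finset.sum_congr rfl fun z hz => ?_
  rw [Finset.mem_filter] at hz
  rw [tent_eq_of_le hz.2.2]

end Energy

/-! ## §3 The `L¹` gradient mass on the punctured inner ball (`d = 3`) -/

section L1

variable {U : Fin P.d → Site P i → (Matrix (Fin N) (Fin N) ℂ)ˣ}

omit U in
/-- `‖X‖ ≤ √(hs X)` (`L²`-operator norm vs Hilbert–Schmidt, lit ✓ `MatrixNorms.opNorm_sq_le_sum_norm_sq`). [folklore] -/
theorem norm_le_sqrt_hs (X : Matrix (Fin N) (Fin N) ℂ) : ‖X‖ ≤ Real.sqrt (∑ j : Fin N, ∑ k : Fin N, ‖X j k‖ ^ 2) :=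
  Real.le_sqrt_of_sq_le (MatrixNorms.opNorm_sq_le_sum_norm_sq X)

/-- ★★★ **THE `L¹` GRADIENT MASS ON THE PUNCTURED INNER BALL** (`d = 3`, unitary `U`, `V` covariantly harmonic on `{0 < tdist(·,y) ≤ 2R+2}`):
`Σ_{1 ≤ tdist(z,y) ≤ R+1} Σ_μ ‖(D_μV)(z)‖ ≤ √(576·(R+1)) · √(27·Σ_{tdist(z,y) ≤ 2R+3} hs V(z))`
(write `‖D_μV‖ ≤ s⁻¹·(s·√hs(D_μV))`, Cauchy–Schwarz over `(z, μ)`, `Σ_{z,μ} s⁻² ≤ 3·192(R+1)` ✓ `sum_inv_tdist_sq_le`, and §2). [cite: Giaquinta1984, Ch. III §1; Balaban1985BackgroundPropagators, (3.8) p.392] -/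
theorem sum_punctured_norm_covD_le (hd : P.d = 3) (hU : ∀ ν x, (U ν x : Matrix (Fin N) (Fin N) ℂ) ∈ unitary (Matrix (Fin N) (Fin N) ℂ))
    (V : Site P i → Matrix (Fin N) (Fin N) ℂ) (y : Site P i) (R : ℕ)
    (hV : ∀ z, 0 < Site.tdist z y → Site.tdist z y ≤ 2 * R + 2 → divB (torusT P i) U (fun μ => covD (torusT P i) U μ V) z = 0) :
    ∑ z ∈ Finset.univ.filter (fun z : Site P i => 1 ≤ Site.tdist z y ∧ Site.tdist z y ≤ R + 1), ∑ μ : Fin P.d, ‖covD (torusT P i) U μ V z‖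
      ≤ Real.sqrt (576 * ((R : ℝ) + 1))
        * Real.sqrt (27 * ∑ z ∈ Finset.univ.filter (fun z : Site P i => Site.tdist z y ≤ 2 * R + 3), ∑ j : Fin N, ∑ k : Fin N, ‖(V z) j k‖ ^ 2) := by
  classical
  set B := Finset.univ.filter (fun z : Site P i => 1 ≤ Site.tdist z y ∧ Site.tdist z y ≤ R + 1) with hBdef
  set Mass := ∑ z ∈ Finset.univ.filter (fun z : Site P i => Site.tdist z y ≤ 2 * R + 3), ∑ j : Fin N, ∑ k : Fin N, ‖(V z) j k‖ ^ 2 with hMass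
  -- the two factors `a(z,μ) := s⁻¹`, `b(z,μ) := s·√hs(D_μV z)`
  set a : Site P i × Fin P.d → ℝ := fun p => ((Site.tdist p.1 y : ℕ) : ℝ)⁻¹ with ha
  set b : Site P i × Fin P.d → ℝ := fun p => ((Site.tdist p.1 y : ℕ) : ℝ) *
      Real.sqrt (∑ j : Fin N, ∑ k : Fin N, ‖(covD (torusT P i) U p.2 V p.1) j k‖ ^ 2) with hb
  -- pointwise `‖D_μV z‖ ≤ a·b` on the punctured ball
  have hpt : ∀ z ∈ B, ∀ μ : Fin P.d, ‖covD (torusT P i) U μ V z‖ ≤ a (z, μ) * b (z, μ) := by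
    intro z hz μ
    rw [hBdef, Finset.mem_filter] at hz
    have hs : (0 : ℝ) < ((Site.tdist z y : ℕ) : ℝ) := by exact_mod_cast hz.2.1
    rw [ha, hb]
    dsimp only
    rw [← mul_assoc, inv_mul_cancel₀ hs.ne', one_mul]
    exact norm_le_sqrt_hs _
  have h1 : ∑ z ∈ B, ∑ μ : Fin P.d, ‖covD (torusT P i) U μ V z‖ ≤ ∑ p ∈ B ×ˢ (Finset.univ : Finset (Fin P.d)), a p * b p := by
    rw [Finset.sum_product]
    exact Finset.sum_le_sum fun z hz => Finset.sum_le_sum fun μ _ => hpt z hz μ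
  have h2 := Real.sum_mul_le_sqrt_mul_sqrt (B ×ˢ (Finset.univ : Finset (Fin P.d))) a b
  -- `Σ a² = d·Σ_B s⁻² ≤ 3·192(R+1)`
  have ha2 : ∑ p ∈ B ×ˢ (Finset.univ : Finset (Fin P.d)), a p ^ 2 ≤ 576 * ((R : ℝ) + 1) := by
    rw [Finset.sum_product]
    have hrad := sum_inv_tdist_sq_le hd B y (M := 1) (N := R + 1) le_rfl (by omega)
      (fun z hz => by rw [hBdef, Finset.mem_filter] at hz; exact hz.2)
    calc ∑ z ∈ B, ∑ _μ : Fin P.d, a (z, _μ) ^ 2 = ∑ z ∈ B, (P.d : ℝ) * ((((Site.tdist z y : ℕ) : ℝ)) ^ 2)⁻¹ := by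
          refine Finset.sum_congr rfl fun z _ => ?_
          simp only [ha, Finset.sum_const, Finset.card_univ, Fintype.card_fin, nsmul_eq_mul, inv_pow]
      _ = (P.d : ℝ) * ∑ z ∈ B, ((((Site.tdist z y : ℕ) : ℝ)) ^ 2)⁻¹ := by rw [Finset.mul_sum]
      _ ≤ 3 * (192 * ((R + 1 : ℕ) : ℝ)) := by
          rw [hd]; push_cast
          exact mul_le_mul_of_nonneg_left (by exact_mod_cast hrad) (by norm_num)
      _ = 576 * ((R : ℝ) + 1) := by push_cast; ring
  -- `Σ b² = Σ_B s²·Σ_μ hs(D_μV) ≤ 27·Mass`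
  have hb2 : ∑ p ∈ B ×ˢ (Finset.univ : Finset (Fin P.d)), b p ^ 2 ≤ 27 * Mass := by
    rw [Finset.sum_product]
    have hE := sum_punctured_sq_hs_covD_le hU V y R hV
    have hd3 : (P.d : ℝ) = 3 := by exact_mod_cast hd
    calc ∑ z ∈ B, ∑ μ : Fin P.d, b (z, μ) ^ 2
        = ∑ z ∈ B, ∑ μ : Fin P.d, ((Site.tdist z y : ℕ) : ℝ) ^ 2 * ∑ j : Fin N, ∑ k : Fin N, ‖(covD (torusT P i) U μ V z) j k‖ ^ 2 := by
          refine Finset.sum_congr rfl fun z _ => Finset.sum_congr rfl fun μ _ => ?_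
          rw [hb]
          dsimp only
          rw [mul_pow, Real.sq_sqrt (Finset.sum_nonneg fun _ _ => Finset.sum_nonneg fun _ _ => sq_nonneg _)]
      _ ≤ 9 * (P.d : ℝ) * Mass := hE
      _ = 27 * Mass := by rw [hd3]; ring
  have hsa : Real.sqrt (∑ p ∈ B ×ˢ (Finset.univ : Finset (Fin P.d)), a p ^ 2) ≤ Real.sqrt (576 * ((R : ℝ) + 1)) := Real.sqrt_le_sqrt ha2
  have hsb : Real.sqrt (∑ p ∈ B ×ˢ (Finset.univ : Finset (Fin P.d)), b p ^ 2) ≤ Real.sqrt (27 * Mass) := Real.sqrt_le_sqrt hb2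
  calc _ ≤ _ := h1
    _ ≤ _ := h2
    _ ≤ Real.sqrt (576 * ((R : ℝ) + 1)) * Real.sqrt (27 * Mass) := mul_le_mul hsa hsb (Real.sqrt_nonneg _) (Real.sqrt_nonneg _)

end L1

end Summit.QuantumFields.YangMills.Theorems.Prop7CovPinJunkSums

end
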